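import Mathlib
import Summits.QuantumAdvantage.QuantumAdvantage.Theorems.AcZeroRung.Negative.LoadBearing
import Literature.NumberTheory.QuadraticFields.ThreeTorsionMeanSquarefreeCount
import Literature.NumberTheory.QuadraticFields.ThreeTorsionMeanProofs

/-!
# Sieve–Walsh lemmas II: the squarefree sieve on a class mod 16, counts, numerics

Helper file for the stub `stub_sieveWalsh` of the crux `ArithStatLadder.AcZeroRung`
(stmt-QuantumAdvantage-2425), line `dyadic-chirp-poisson`.

RUNNING LOG (worker): arithmetic half of the proof, complete.  Contents:
* `sieveWalsh_live_classes` (anchor, registered) — `-d` fundamental forces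
  `d mod 16 ∈ {3,7,11,15,4,8}`;
* `sieve_exists_oddPart` — in a live class, `d = 2^v k`, `k` odd, and `NegFund d ↔ Squarefree k`
  (the 2-adic trichotomy);
* `sieve_ite_negFund_eq_sum` — `1_{NegFund}(d) = Σ_{q ≤ N, q odd, q² ∣ d} μ(q)` (tree:
  `sqfreeInd_eq_sum_moebius` applied to the odd part);
* `sieve_sum_famD_filter_eq` — the swapped sieve identity on a class of `𝒟_n`;
* `sieve_exists_modEq_iff` — CRT: `d ≡ r (16) ∧ q² ∣ d` is one class mod `16 q²` (`q` odd);
* `sieve_card_filter_sq_dvd_le` — `#{d < 2^n : q² ∣ d} ≤ 2^n / q²`;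
* `sieve_exists_poly_le_two_pow`, `sieve_eventually_numerics` — polylog ≪ n;
* `sieve_card_famD_lower`, `sieve_famD_card_eventually` — `#𝒟_n ≥ 2ⁿ/8` eventually (copied from
  the lead's skeleton, tree count `abs_card_negFundDiscrs_sub_le`).
-/

set_option linter.dupNamespace false -- D-0017: single-problem summit ⇒ QuantumAdvantage.QuantumAdvantage by design

noncomputable section

namespace Summit.QuantumAdvantage.QuantumAdvantage.Theorems.AcZeroRung

open Finset Filter
open scoped ArithmeticFunction.Moebius Classical
open Summit.QuantumAdvantage.QuantumAdvantage.Theorems.AcZeroRung.Negative (famD NegFund mem_famD)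
open Literature.NumberTheory.LFunctions (sqfreeInd sqfreeInd_eq_sum_moebius)
open Literature.NumberTheory.QuadraticFields (negFundDiscrs mem_negFundDiscrs
  abs_card_negFundDiscrs_sub_le squarefree_neg_natCast)

/-! ### The 2-adic trichotomy inside a class mod 16 -/

/-- LIVE CLASSES (anchor lemma of this helper file): `-d` fundamental ⇒ `d ≡ 3 (mod 4)` or
`d ≡ 4, 8 (mod 16)`. -/
theorem sieveWalsh_live_classes : ∀ d : ℕ, NegFund d → d % 4 = 3 ∨ d % 16 = 4 ∨ d % 16 = 8 := by
  intro d h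
  unfold NegFund at h
  rcases h with ⟨h1, -, -⟩ | ⟨⟨k, hk⟩, h23, -⟩
  · left; omega
  · right; omega

/-- In a live class: `d = 2^v · k` with `k` odd and `NegFund d ↔ Squarefree k`
(`v = 0, 2, 3` for `d ≡ 3 (4)`, `d ≡ 4 (16)`, `d ≡ 8 (16)`). -/
theorem sieve_exists_oddPart {d : ℕ} (hd : d % 4 = 3 ∨ d % 16 = 4 ∨ d % 16 = 8) :
    ∃ v k : ℕ, d = 2 ^ v * k ∧ Odd k ∧ (NegFund d ↔ Squarefree k) := by
  rcases hd with h | h | h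
  · refine ⟨0, d, by simp, by rw [Nat.odd_iff]; omega, ?_⟩
    unfold NegFund
    have h1 : (-(d : ℤ)) % 4 = 1 := by omega
    have h2 : ¬ (4 ∣ (-(d : ℤ))) := by omega
    have h3 : (-(d : ℤ)) ≠ 1 := by omega
    simp only [h1, h2, h3, true_and, false_and, or_false, ne_eq, not_false_eq_true, and_true]
    exact squarefree_neg_natCast
  · refine ⟨2, d / 4, by omega, by rw [Nat.odd_iff]; omega, ?_⟩
    have h1 : (-(d : ℤ)) % 4 ≠ 1 := by omega
    have h2 : (4 ∣ (-(d : ℤ))) := ⟨-((d / 4 : ℕ) : ℤ), by omega⟩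
    have h3 : (-(d : ℤ)) / 4 = -((d / 4 : ℕ) : ℤ) := by omega
    have h4 : (-((d / 4 : ℕ) : ℤ)) % 4 = 3 := by omega
    unfold NegFund
    rw [h3]
    constructor
    · rintro (⟨h, -, -⟩ | ⟨-, -, hsq⟩)
      · exact absurd h h1
      · rwa [squarefree_neg_natCast] at hsq
    · intro hsq
      exact Or.inr ⟨h2, Or.inr h4, by rwa [squarefree_neg_natCast]⟩
  · refine ⟨3, d / 8, by omega, by rw [Nat.odd_iff]; omega, ?_⟩
    have h1 : (-(d : ℤ)) % 4 ≠ 1 := by omega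
    have h2 : (4 ∣ (-(d : ℤ))) := ⟨-((2 * (d / 8) : ℕ) : ℤ), by push_cast; omega⟩
    have h3 : (-(d : ℤ)) / 4 = -((2 * (d / 8) : ℕ) : ℤ) := by push_cast; omega
    have h4 : (-((2 * (d / 8) : ℕ) : ℤ)) % 4 = 2 := by push_cast; omega
    have hodd : Odd (d / 8) := by rw [Nat.odd_iff]; omega
    unfold NegFund
    rw [h3]
    constructor
    · rintro (⟨h, -, -⟩ | ⟨-, -, hsq⟩)
      · exact absurd h h1
      · rw [squarefree_neg_natCast, Nat.squarefree_mul_iff] at hsq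
        exact hsq.2.2
    · intro hsq
      refine Or.inr ⟨h2, Or.inl h4, ?_⟩
      rw [squarefree_neg_natCast, Nat.squarefree_mul_iff]
      exact ⟨Nat.coprime_two_left.2 hodd, Nat.prime_two.squarefree, hsq⟩

/-- For `d = 2^v k`, `k` odd: the square divisors of `k` are the odd square divisors of `d`. -/
theorem sieve_filter_sq_dvd_oddPart {d v k : ℕ} (hd : d = 2 ^ v * k) (hk : Odd k) (s : Finset ℕ) :
    s.filter (fun q => q ^ 2 ∣ k) = s.filter (fun q => Odd q ∧ q ^ 2 ∣ d) := by
  refine Finset.filter_congr fun q _ => ?_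
  constructor
  · intro h
    exact ⟨Odd.of_dvd_nat hk ((dvd_pow_self q two_ne_zero).trans h), hd ▸ h.mul_left _⟩
  · rintro ⟨hq, hqd⟩
    have hcop : Nat.Coprime (q ^ 2) (2 ^ v) := Nat.Coprime.pow 2 v (Nat.coprime_two_right.2 hq)
    exact hcop.dvd_of_dvd_mul_left (hd ▸ hqd)

/-- THE SIEVE ON A LIVE CLASS: `1_{NegFund}(d) = Σ_{1 ≤ q ≤ N, q odd, q² ∣ d} μ(q)` (`0 < d ≤ N`). -/
theorem sieve_ite_negFund_eq_sum {d N : ℕ} (hd : d % 4 = 3 ∨ d % 16 = 4 ∨ d % 16 = 8)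
    (h0 : 0 < d) (hN : d ≤ N) :
    (if NegFund d then (1 : ℝ) else 0) =
      ∑ q ∈ (Icc 1 N).filter (fun q => Odd q ∧ q ^ 2 ∣ d), (μ q : ℝ) := by
  obtain ⟨v, k, hdk, hk, hiff⟩ := sieve_exists_oddPart hd
  have hk0 : 0 < k := hk.pos
  have hkN : k ≤ N := (Nat.le_of_dvd h0 ⟨2 ^ v, by rw [hdk]; ring⟩).trans hN
  rw [← sieve_filter_sq_dvd_oddPart hdk hk, ← sqfreeInd_eq_sum_moebius hk0 hkN, sqfreeInd]
  by_cases hs : Squarefree k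
  · rw [if_pos hs, if_pos (hiff.2 hs)]
  · rw [if_neg hs, if_neg (fun h => hs (hiff.1 h))]

/-- THE SWAPPED SIEVE IDENTITY on a class `r (mod 16)` of `𝒟_n` (`r` live):
`Σ_{d ∈ 𝒟_n, d ≡ r} F(d) = Σ_{1 ≤ q ≤ 2ⁿ} μ(q) Σ_{2^{n-1} ≤ d < 2ⁿ, d ≡ r, q odd, q² ∣ d} F(d)`. -/
theorem sieve_sum_famD_filter_eq (n r : ℕ) (F : ℕ → ℝ) (hr : r % 4 = 3 ∨ r = 4 ∨ r = 8) :
    ∑ d ∈ (famD n).filter (fun d => d % 16 = r), F d =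
      ∑ q ∈ Icc 1 (2 ^ n), (μ q : ℝ) *
        ∑ d ∈ ((Ico (2 ^ (n - 1)) (2 ^ n)).filter (fun d => d % 16 = r)).filter
          (fun d => Odd q ∧ q ^ 2 ∣ d), F d := by
  set B := (Ico (2 ^ (n - 1)) (2 ^ n)).filter (fun d => d % 16 = r) with hB
  have hset : (famD n).filter (fun d => d % 16 = r) = B.filter (fun d => NegFund d) := by
    ext d
    simp only [Finset.mem_filter, mem_famD, Finset.mem_Ico, hB]
    tauto
  rw [hset, Finset.sum_filter]
  have hlive : ∀ d ∈ B, (d % 4 = 3 ∨ d % 16 = 4 ∨ d % 16 = 8) ∧ 0 < d ∧ d ≤ 2 ^ n := by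
    intro d hd
    simp only [hB, Finset.mem_filter, Finset.mem_Ico] at hd
    have : 1 ≤ 2 ^ (n - 1) := Nat.one_le_two_pow
    exact ⟨by omega, by omega, hd.1.2.le⟩
  calc ∑ d ∈ B, (if NegFund d then F d else 0)
      = ∑ d ∈ B, (if NegFund d then (1 : ℝ) else 0) * F d := by
        refine Finset.sum_congr rfl fun d _ => ?_
        split_ifs <;> simp
    _ = ∑ d ∈ B, (∑ q ∈ (Icc 1 (2 ^ n)).filter (fun q => Odd q ∧ q ^ 2 ∣ d), (μ q : ℝ)) * F d := by
        refine Finset.sum_congr rfl fun d hd => ?_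
        obtain ⟨h1, h2, h3⟩ := hlive d hd
        rw [sieve_ite_negFund_eq_sum h1 h2 h3]
    _ = ∑ d ∈ B, ∑ q ∈ Icc 1 (2 ^ n), (if Odd q ∧ q ^ 2 ∣ d then (μ q : ℝ) * F d else 0) := by
        refine Finset.sum_congr rfl fun d _ => ?_
        simp only [Finset.sum_filter, Finset.sum_mul, ite_mul, zero_mul]
    _ = ∑ q ∈ Icc 1 (2 ^ n), ∑ d ∈ B, (if Odd q ∧ q ^ 2 ∣ d then (μ q : ℝ) * F d else 0) :=
        Finset.sum_comm
    _ = _ := by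
        refine Finset.sum_congr rfl fun q _ => ?_
        simp only [Finset.mul_sum, Finset.sum_filter, mul_ite, mul_zero]

/-! ### Progressions and counts -/

/-- CRT: for `q` odd and `r < 16`, `{d : d % 16 = r ∧ q² ∣ d}` is one residue class mod `16 q²`. -/
theorem sieve_exists_modEq_iff {q r : ℕ} (hq : Odd q) (hr : r < 16) :
    ∃ c : ℕ, ∀ d : ℕ, (d % 16 = r ∧ q ^ 2 ∣ d) ↔ d ≡ c [MOD 16 * q ^ 2] := by
  have hcop : Nat.Coprime 16 (q ^ 2) := by
    have h := Nat.Coprime.pow 4 2 (Nat.coprime_two_left.2 hq)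
    rwa [show (2 : ℕ) ^ 4 = 16 by norm_num] at h
  obtain ⟨c, hc16, hcq⟩ := Nat.chineseRemainder hcop r 0
  refine ⟨c, fun d => ?_⟩
  rw [← Nat.modEq_and_modEq_iff_modEq_mul hcop]
  have hr' : d % 16 = r ↔ d ≡ r [MOD 16] := by
    unfold Nat.ModEq; rw [Nat.mod_eq_of_lt hr]
  rw [hr']
  constructor
  · rintro ⟨h1, h2⟩
    exact ⟨h1.trans hc16.symm, (Nat.modEq_zero_iff_dvd.2 h2).trans hcq.symm⟩
  · rintro ⟨h1, h2⟩
    exact ⟨h1.trans hc16, Nat.modEq_zero_iff_dvd.1 (h2.trans hcq)⟩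

/-- TAIL COUNT: `#{2^{n-1} ≤ d < 2ⁿ : d ≡ r, q odd, q² ∣ d} ≤ 2ⁿ/q²` (`q ≥ 1`). -/
theorem sieve_card_filter_sq_dvd_le {n q : ℕ} (r : ℕ) (hq : 0 < q) :
    (((((Ico (2 ^ (n - 1)) (2 ^ n)).filter (fun d => d % 16 = r)).filter
        (fun d => Odd q ∧ q ^ 2 ∣ d)).card : ℕ) : ℝ) ≤ (2 : ℝ) ^ n / (q : ℝ) ^ 2 := by
  classical
  have hsub : ((Ico (2 ^ (n - 1)) (2 ^ n)).filter (fun d => d % 16 = r)).filter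
      (fun d => Odd q ∧ q ^ 2 ∣ d) ⊆ (Ioc 0 (2 ^ n - 1)).filter (fun d => q ^ 2 ∣ d) := by
    intro d hd
    simp only [Finset.mem_filter, Finset.mem_Ico, Finset.mem_Ioc] at hd ⊢
    have : 1 ≤ 2 ^ (n - 1) := Nat.one_le_two_pow
    exact ⟨⟨by omega, by omega⟩, hd.2.2⟩
  have h1 := Finset.card_le_card hsub
  rw [Nat.Ioc_filter_dvd_card_eq_div] at h1
  have h2 : (((2 ^ n - 1) / q ^ 2 : ℕ) : ℝ) ≤ ((2 ^ n - 1 : ℕ) : ℝ) / ((q ^ 2 : ℕ) : ℝ) :=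
    Nat.cast_div_le
  have h3 : ((2 ^ n - 1 : ℕ) : ℝ) ≤ (2 : ℝ) ^ n := by
    have : 2 ^ n - 1 ≤ 2 ^ n := Nat.sub_le _ _
    exact_mod_cast this
  have hq2 : (0 : ℝ) < (q : ℝ) ^ 2 := by positivity
  calc _ ≤ (((2 ^ n - 1) / q ^ 2 : ℕ) : ℝ) := by exact_mod_cast h1
    _ ≤ ((2 ^ n - 1 : ℕ) : ℝ) / ((q ^ 2 : ℕ) : ℝ) := h2
    _ ≤ (2 : ℝ) ^ n / (q : ℝ) ^ 2 := by push_cast; gcongr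

/-! ### Numerics: polylog ≪ n, and the size of `𝒟_n` -/

/-- Exponential beats polynomial: `C · L^k ≤ 2^L` for `L ≥ L₀(k, C)`. -/
theorem sieve_exists_poly_le_two_pow (k C : ℕ) : ∃ L₀ : ℕ, ∀ L ≥ L₀, C * L ^ k ≤ 2 ^ L := by
  have h := tendsto_pow_const_div_const_pow_of_one_lt k (one_lt_two : (1 : ℝ) < 2)
  have hε : (0 : ℝ) < 1 / (C + 1) := by positivity
  obtain ⟨L₀, hL₀⟩ := (h.eventually (gt_mem_nhds hε)).exists_forall_of_atTop
  refine ⟨L₀, fun L hL => ?_⟩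
  have h1 := hL₀ L hL
  have h2 : (0 : ℝ) < 2 ^ L := by positivity
  rw [div_lt_div_iff₀ h2 (by positivity), one_mul] at h1
  have h3 : (C : ℝ) * (L : ℝ) ^ k ≤ (L : ℝ) ^ k * (C + 1) := by
    nlinarith [pow_nonneg (Nat.cast_nonneg L : (0 : ℝ) ≤ L) k]
  exact_mod_cast h3.trans h1.le

/-- EVENTUALLY IN `n`: `(2 L^{A+2} + 10)(L^A + 1) + 4 ≤ n` for `L = log₂ n`. -/
theorem sieve_eventually_numerics (A : ℕ) : ∀ᶠ n : ℕ in atTop,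
    (2 * Nat.log 2 n ^ (A + 2) + 10) * (Nat.log 2 n ^ A + 1) + 4 ≤ n := by
  obtain ⟨L₀, hL₀⟩ := sieve_exists_poly_le_two_pow (2 * A + 4) 28
  filter_upwards [eventually_ge_atTop (2 ^ (L₀ + 1))] with n hn
  set L := Nat.log 2 n with hL
  have hn0 : n ≠ 0 := by have : 1 ≤ 2 ^ (L₀ + 1) := Nat.one_le_two_pow; omega
  have hL1 : L₀ + 1 ≤ L := Nat.le_log_of_pow_le one_lt_two hn
  have h2L : 2 ^ L ≤ n := Nat.pow_log_le_self 2 hn0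
  have hpoly : (2 * L ^ (A + 2) + 10) * (L ^ A + 1) + 4 ≤ 28 * L ^ (2 * A + 4) := by
    have hL1' : 1 ≤ L := by omega
    have hA : 1 ≤ L ^ A := Nat.one_le_pow _ _ hL1'
    have hA2 : L ^ A ≤ L ^ (A + 2) := Nat.pow_le_pow_right hL1' (by omega)
    have hsq : L ^ (2 * A + 4) = L ^ (A + 2) * L ^ (A + 2) := by rw [← pow_add]; congr 1; omega
    rw [hsq]
    nlinarith
  calc _ ≤ 28 * L ^ (2 * A + 4) := hpoly
    _ ≤ 2 ^ L := hL₀ L (by omega)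
    _ ≤ n := h2L

/-- `𝒟_n` receives `negFundDiscrs 2ⁿ \ negFundDiscrs 2ⁿ⁻¹` injectively under `D ↦ |D|`
(copied from the lead's skeleton). -/
theorem sieve_card_sdiff_le_card_famD (n : ℕ) :
    ((negFundDiscrs (2 ^ n)) \ (negFundDiscrs (2 ^ (n - 1)))).card ≤ (famD n).card := by
  refine Finset.card_le_card_of_injOn (fun D : ℤ => D.natAbs) ?_ ?_
  · intro D hD
    rw [Finset.mem_coe, Finset.mem_sdiff, mem_negFundDiscrs, mem_negFundDiscrs] at hD
    obtain ⟨⟨⟨hlo, hneg⟩, hf⟩, hnot⟩ := hD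
    have hcast : ((D.natAbs : ℕ) : ℤ) = -D := Int.ofNat_natAbs_of_nonpos hneg.le
    rw [Finset.mem_coe, mem_famD]
    refine ⟨⟨?_, ?_⟩, ?_⟩
    · by_contra hle
      have hlt : D.natAbs < 2 ^ (n - 1) := Nat.lt_of_not_le hle
      apply hnot
      refine ⟨⟨?_, hneg⟩, hf⟩
      have h1 : ((D.natAbs : ℕ) : ℤ) < ((2 ^ (n - 1) : ℕ) : ℤ) := by exact_mod_cast hlt
      rw [hcast] at h1
      linarith
    · have h1 : ((D.natAbs : ℕ) : ℤ) < ((2 ^ n : ℕ) : ℤ) := by rw [hcast]; linarith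
      exact_mod_cast h1
    · show NegFund D.natAbs
      unfold NegFund
      rw [show -((D.natAbs : ℕ) : ℤ) = D by omega]
      exact hf
  · intro D₁ h₁ D₂ h₂ heq
    rw [Finset.mem_coe, Finset.mem_sdiff, mem_negFundDiscrs] at h₁ h₂
    have e₁ : ((D₁.natAbs : ℕ) : ℤ) = -D₁ := Int.ofNat_natAbs_of_nonpos h₁.1.1.2.le
    have e₂ : ((D₂.natAbs : ℕ) : ℤ) = -D₂ := Int.ofNat_natAbs_of_nonpos h₂.1.1.2.le
    have h : ((D₁.natAbs : ℕ) : ℤ) = ((D₂.natAbs : ℕ) : ℤ) := by exact_mod_cast heq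
    linarith

/-- LOWER BOUND FOR THE BLOCK: `#𝒟_n ≥ (3/(2π²))·2ⁿ − 16·√(2ⁿ)` (`n ≥ 1`), from the tree's count
`|#negFundDiscrs X − (3/π²) X| ≤ 8√X` at `X = 2ⁿ, 2ⁿ⁻¹` (copied from the lead's skeleton). -/
theorem sieve_card_famD_lower {n : ℕ} (hn : 1 ≤ n) :
    3 / (2 * Real.pi ^ 2) * (2 : ℝ) ^ n - 16 * Real.sqrt ((2 : ℝ) ^ n) ≤ ((famD n).card : ℝ) := by
  obtain ⟨m, rfl⟩ : ∃ m, n = m + 1 := ⟨n - 1, by omega⟩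
  have h := sieve_card_sdiff_le_card_famD (m + 1)
  have h' : (negFundDiscrs (2 ^ (m + 1))).card ≤
      (famD (m + 1)).card + (negFundDiscrs (2 ^ (m + 1 - 1))).card :=
    (Finset.card_le_card_sdiff_add_card).trans (Nat.add_le_add_right h _)
  simp only [Nat.add_sub_cancel] at h'
  have hbig := abs_card_negFundDiscrs_sub_le (2 ^ (m + 1))
  have hsmall := abs_card_negFundDiscrs_sub_le (2 ^ m)
  rw [abs_le] at hbig hsmall
  push_cast at hbig hsmall
  have hcast : ((negFundDiscrs (2 ^ (m + 1))).card : ℝ) ≤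
      ((famD (m + 1)).card : ℝ) + ((negFundDiscrs (2 ^ m)).card : ℝ) := by exact_mod_cast h'
  have hsq : Real.sqrt ((2 : ℝ) ^ m) ≤ Real.sqrt ((2 : ℝ) ^ (m + 1)) :=
    Real.sqrt_le_sqrt (pow_le_pow_right₀ one_le_two (Nat.le_succ m))
  have hpm : (2 : ℝ) ^ (m + 1) = 2 * 2 ^ m := pow_succ' 2 m
  rw [hpm] at hbig hsq ⊢
  set X : ℝ := (2 : ℝ) ^ m with hX
  set c : ℝ := 3 / Real.pi ^ 2 with hc_def
  have hgoal : 3 / (2 * Real.pi ^ 2) * (2 * X) = c * X := by rw [hc_def]; ring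
  have e1 : c * (2 * X) = 2 * (c * X) := by ring
  rw [hgoal]
  rw [e1] at hbig
  linarith [hbig.1, hsmall.2, hcast, hsq]

/-- Eventually `#𝒟_n ≥ 2ⁿ/8` (`3/(2π²) > 17/128` by `π < 3.15`, and `16√(2ⁿ) ≤ 2ⁿ/128` for
`n ≥ 22`; copied from the lead's skeleton). -/
theorem sieve_famD_card_eventually : ∀ᶠ n : ℕ in atTop, (2 : ℝ) ^ n / 8 ≤ ((famD n).card : ℝ) := by
  filter_upwards [eventually_ge_atTop 22] with n hn
  have hlow := sieve_card_famD_lower (show 1 ≤ n by omega)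
  have h2n : (0 : ℝ) < (2 : ℝ) ^ n := by positivity
  have hsqrt : Real.sqrt ((2 : ℝ) ^ n) ≤ (2 : ℝ) ^ n / 2048 := by
    rw [Real.sqrt_le_left (by positivity)]
    have h22 : (2 : ℝ) ^ 22 ≤ (2 : ℝ) ^ n := pow_le_pow_right₀ one_le_two hn
    have h2048 : ((2 : ℝ) ^ n / 2048) ^ 2 = (2 : ℝ) ^ n * ((2 : ℝ) ^ n / 2 ^ 22) := by
      norm_num; ring
    rw [h2048]
    have : (1 : ℝ) ≤ (2 : ℝ) ^ n / 2 ^ 22 := by rw [le_div_iff₀ (by positivity)]; linarith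
    nlinarith
  have hpi2 : Real.pi ^ 2 < 9.9225 := by nlinarith [Real.pi_lt_d2, Real.pi_pos]
  have key : (17 : ℝ) / 128 ≤ 3 / (2 * Real.pi ^ 2) := by
    rw [div_le_div_iff₀ (by norm_num) (by positivity)]
    nlinarith [hpi2]
  have hk := mul_le_mul_of_nonneg_right key h2n.le
  linarith

end Summit.QuantumAdvantage.QuantumAdvantage.Theorems.AcZeroRung

end
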